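import Summits.CriticalPhenomena.PercolationContinuityZ3.Theorems.Transplant.BoxProdZ2TubeLevels
import Summits.CriticalPhenomena.PercolationContinuityZ3.Theorems.Transplant.KNCells2ChainAdv
import Summits.CriticalPhenomena.PercolationContinuityZ3.Theorems.Transplant.KNLevelsTargetChain
import HarnessLib

/-!
# The STRAIGHT-RUN chain of `X □ ℤ²` as target steps in a tube graph (design (D): the ROOT PROBE chain of `hQ0` — which must run OUTSIDE the
# wired root cube, from a first fresh core in `Btw(0,du)` to `M_{du}` — and the ELONGATED inner routes of the face step; planar schedule =
# `ChainPlanar.Adv` (KNCells2ChainAdv, Lemma 11 straight run: start box `{|level| ≤ q, |trans| ≤ q'}`, then `N + 1` faces advancing by `s₁`);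
# companion of `KNCellsBoxProdZ2ChainT` (which uses the `Sched` schedule starting inside `Q_x`)

builds on p205010 (kernel theorem, internal audit signed; external expert review pending) — nothing in this file uses p205010.
Lane `prim-bschramm`, seat `prim-bschramm-p2` (G4/D8); helper file (`--supports stmt-CriticalPhenomena-4575`).

* `TubeAdvData` (`π`, start-box parameters `q q' s₁ ρ`, `R'`, number of advance steps `nA`, axis `ax`, sign `sg`, centre `c`, `Rlev N j₀ j₁`,
  source, support, rim parts); `alo/ahi/acore/aregion` (the straight-run boxes), `stepL/stepD`, true target `coreT k = π ×ˢ core_{k+1}` (linked),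
  enlarged target `coreE k = coreT k ∪ Rim k`, `stepA k : TStep (tubeGraph X π)`;
* `encl` (from `Adv.enlarge_core_subset_region`), `coreT_subset_stepD` (`Adv.core_succ_subset_region`), `stepD_subset_prism`
  (`Adv.region_subset_prism`), `coreT_nonempty`, `core_zero_subset_X_zero`, `coreT_last_eq`, **`kitsAt_stepA`** (p3-g2's `kitClauseQ` verbatim).
[cite: KozmaNitzan2024, §4 Lemma 10 (p. 17), Lemma 11 (pp. 22–23)]
-/

noncomputable section

open MeasureTheory ProbabilityTheory
open scoped ENNReal

namespace Summit.CriticalPhenomena.PercolationContinuityZ3.Theorems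

namespace Transplant

namespace BoxProdZ2

open Literature.Probability.Percolation Literature.Probability.LatticeModels SimpleGraph
open Literature.Probability.Percolation.KozmaNitzan
open KNLevels ChainPlanar

variable {W : Type} [DecidableEq W] (X : SimpleGraph W) [X.LocallyFinite]

/-- **The data of a straight-run chain in a tube graph.** [cite: KozmaNitzan2024, §4 Lemma 11 (pp. 22–23)] -/
structure TubeAdvData (W : Type) where
  /-- the fibre window -/
  π : Finset W
  /-- half-length of the start box along the axis -/
  q : ℤ
  /-- half-width of the start box -/
  q' : ℤ
  /-- the advance per step -/
  s₁ : ℤ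
  /-- half-width of the prism containing all regions -/
  ρ : ℤ
  /-- the planar neighbourhood radius `R' ≥ Rlev + 1` -/
  R' : ℕ
  /-- the minimal route scale -/
  ℓ₀ : ℕ
  /-- the number of advance steps after the start step -/
  nA : ℕ
  /-- the axis -/
  ax : Fin 2
  /-- the sign along the axis -/
  sg : ℤ
  /-- the centre of the start box -/
  c : Site 2
  /-- the level depth of every step -/
  Rlev : ℕ
  /-- the number of contacts demanded by Step II -/
  N : ℕ
  /-- the level window -/
  j₀ : ℕ
  /-- the level window -/
  j₁ : ℕ
  /-- the source -/
  root : W × Site 2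
  /-- the finite support of the weighting -/
  Sfin : Finset (W × Site 2)
  /-- the rim part of the enlarged target of step `k` -/
  Rim : ℕ → Finset (W × Site 2)

namespace TubeAdvData

variable {X} (P : TubeAdvData W)

/-- Lower corner of core `k`. [folklore] -/
def alo (k : ℕ) : Site 2 := sLo P.ax P.sg P.c (Adv.coreα P.q P.s₁ k) (Adv.coreβ P.q P.s₁ k) (Adv.coreW P.q P.q' P.s₁ P.R' k)

/-- Upper corner of core `k`. [folklore] -/
def ahi (k : ℕ) : Site 2 := sHi P.ax P.sg P.c (Adv.coreα P.q P.s₁ k) (Adv.coreβ P.q P.s₁ k) (Adv.coreW P.q P.q' P.s₁ P.R' k)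

/-- The planar core `k` of the straight run. [folklore] -/
def acore (k : ℕ) : Finset (Site 2) := Adv.core P.q P.q' P.s₁ P.R' P.ax P.sg P.c k

/-- The planar region `k` of the straight run. [folklore] -/
def aregion (k : ℕ) : Finset (Site 2) := Adv.region P.q P.s₁ P.ρ P.ax P.sg P.c k

variable (X)

/-- **The level data of step `k`** (tube levels of core `k`). [cite: KozmaNitzan2024, §4 Lemma 10 (p. 17)] -/
def stepL (k : ℕ) : LData (tubeGraph X P.π) := tubeLData X P.π (P.alo k) (P.ahi k) P.root P.Sfin

/-- **The region of step `k`**: `π × region_k`. [cite: KozmaNitzan2024, §4 Lemma 10 (p. 17: D)] -/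
def stepD (k : ℕ) : Finset (W × Site 2) := P.π ×ˢ P.aregion k

/-- **The true target of step `k`**: `π × core_{k+1}`. [cite: KozmaNitzan2024, §4 Lemma 10 (p. 17: T)] -/
def coreT (k : ℕ) : Finset (W × Site 2) := P.π ×ˢ P.acore (k + 1)

/-- **The enlarged target of step `k`.** [cite: KozmaNitzan2024, §4 p. 30] -/
def coreE (k : ℕ) : Finset (W × Site 2) := P.coreT k ∪ P.Rim k

/-- **Step `k` as a target step** (enlarged target). [cite: KozmaNitzan2024, §4 Lemma 11 (pp. 22–23)] -/
def stepA (k : ℕ) : TStep (tubeGraph X P.π) := ⟨P.stepL X k, P.stepD k, P.coreE k, P.Rlev, P.N, P.j₀, P.j₁⟩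

/-! ### The levels, the link, the containments -/

omit [DecidableEq W] [X.LocallyFinite] in
/-- **The levels of step `k`**: `π × sBox(coreα k - j, coreβ k + j, coreW k + j)` (for a sign `sg = ±1`). [cite: KozmaNitzan2024, §4 p. 15 (B⟨j⟩)] -/
theorem stepL_X (hsg : P.sg = 1 ∨ P.sg = -1) (k j : ℕ) : (P.stepL X k).X j =
    P.π ×ˢ sBox P.ax P.sg P.c (Adv.coreα P.q P.s₁ k - j) (Adv.coreβ P.q P.s₁ k + j) (Adv.coreW P.q P.q' P.s₁ P.R' k + j) := by
  rw [stepL, tubeLData_X]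
  show tubeLevel P.π (P.alo k) (P.ahi k) j = _
  rw [tubeLevel, alo, ahi, sBox_enlarge _ _ hsg]

omit [DecidableEq W] [X.LocallyFinite] in
/-- The first level of step `k` is `π × core_k`. [folklore] -/
theorem stepL_X_zero (hsg : P.sg = 1 ∨ P.sg = -1) (k : ℕ) : (P.stepL X k).X 0 = P.π ×ˢ P.acore k := by
  rw [P.stepL_X X hsg]; push_cast; simp only [sub_zero, add_zero]; rfl

omit [X.LocallyFinite] in
/-- **The true targets link the chain**: `T'_k ⊆ X^{(k+1)}_0`. [cite: KozmaNitzan2024, §4 Lemma 12] -/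
theorem coreT_subset_X_zero_succ (hsg : P.sg = 1 ∨ P.sg = -1) (k : ℕ) : P.coreT k ⊆ (P.stepA X (k + 1)).L.X 0 := by
  show P.coreT k ⊆ (P.stepL X (k + 1)).X 0
  rw [P.stepL_X_zero X hsg]; exact subset_rfl

omit [X.LocallyFinite] in
/-- The true target lies in the enlarged target. [folklore] -/
theorem coreT_subset_coreE (k : ℕ) : P.coreT k ⊆ (P.stepA X k).T := Finset.subset_union_left

omit [X.LocallyFinite] in
/-- The excess part of the enlarged target is inside the rim part. [folklore] -/
theorem coreE_sdiff_subset (k : ℕ) : (P.stepA X k).T \ P.coreT k ⊆ P.Rim k := by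
  intro v hv
  rw [Finset.mem_sdiff] at hv
  rcases Finset.mem_union.1 hv.1 with h | h
  · exact absurd h hv.2
  · exact h

omit [X.LocallyFinite] in
/-- The sources agree. [folklore] -/
theorem stepA_o (k : ℕ) : (P.stepA X k).L.o = P.root := rfl

variable {P}
variable (hsg : P.sg = 1 ∨ P.sg = -1) (hOK : Adv.AdvOK P.q P.q' P.s₁ P.ρ P.R' P.ℓ₀ P.nA)
include hsg hOK

omit [DecidableEq W] [X.LocallyFinite] in
/-- **`X^{(k)}_{Rlev+1} ⊆ D_k`** when `Rlev + 1 ≤ R'` (`k ≤ nA`). [cite: KozmaNitzan2024, §4 Lemma 10 (p. 17: B⟨R+1⟩ ⊆ D)] -/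
theorem encl (hRl : P.Rlev + 1 ≤ P.R') {k : ℕ} (hk : k ≤ P.nA) : (P.stepL X k).X (P.Rlev + 1) ⊆ P.stepD k := by
  rw [P.stepL_X X hsg, stepD]
  refine Finset.product_subset_product_right
    ((sBox_mono hsg _ ?_ ?_ ?_).trans (Adv.enlarge_core_subset_region hsg P.c hOK hk)) <;> push_cast <;> omega

omit [DecidableEq W] [X.LocallyFinite] in
/-- **`T'_k ⊆ D_k`** (`k ≤ nA`). [folklore] -/
theorem coreT_subset_stepD {k : ℕ} (hk : k ≤ P.nA) : P.coreT k ⊆ P.stepD k :=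
  Finset.product_subset_product_right (Adv.core_succ_subset_region hsg P.c hOK hk)

omit [X.LocallyFinite] in
/-- **`T_k ⊆ D_k`** when the rim part lies in the region. [folklore] -/
theorem coreE_subset_stepD (hRim : ∀ k, P.Rim k ⊆ P.stepD k) {k : ℕ} (hk : k ≤ P.nA) : P.coreE k ⊆ P.stepD k :=
  Finset.union_subset (coreT_subset_stepD hsg hOK hk) (hRim k)

omit [DecidableEq W] [X.LocallyFinite] in
/-- **`D_k` lies in the prism `π × {-ρ ≤ level ≤ q + (nA+1)s₁, |trans| ≤ ρ}`.** [cite: KozmaNitzan2024, §4 Lemma 11 (p. 22: Ω)] -/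
theorem stepD_subset_prism {k : ℕ} (hk : k ≤ P.nA) :
    P.stepD k ⊆ P.π ×ˢ sBox P.ax P.sg P.c (-P.ρ) (P.q + ((P.nA : ℤ) + 1) * P.s₁) P.ρ :=
  Finset.product_subset_product_right (Adv.region_subset_prism hsg P.c hOK hk)

omit [DecidableEq W] [X.LocallyFinite] in
/-- **`T'_k` is nonempty** as soon as the window is. [folklore] -/
theorem coreT_nonempty (hπ : P.π.Nonempty) (k : ℕ) : (P.coreT k).Nonempty := by
  obtain ⟨s, hs⟩ := Adv.core_nonempty hsg P.c hOK (k + 1) (q := P.q) (q' := P.q') (s₁ := P.s₁) (R' := P.R') (a := P.ax)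
  obtain ⟨β, hβ⟩ := hπ
  exact ⟨(β, s), Finset.mem_product.2 ⟨hβ, hs⟩⟩

omit hOK in
omit [DecidableEq W] [X.LocallyFinite] in
/-- **The start box lies in the first level**: `π' × {|level| ≤ q, |trans| ≤ q'} ⊆ X^{(0)}_0` for `π' ⊆ π`. [folklore] -/
theorem startBox_subset_X_zero {π' : Finset W} (hπ' : π' ⊆ P.π) : π' ×ˢ sBox P.ax P.sg P.c (-P.q) P.q P.q' ⊆ (P.stepL X 0).X 0 := by
  rw [P.stepL_X_zero X hsg]
  refine Finset.product_subset_product hπ' ?_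
  rw [acore, (Adv.core_zero_last (q := P.q) (q' := P.q') (s₁ := P.s₁) (R' := P.R') (N := P.nA) (a := P.ax) (σ := P.sg) (c := P.c)).1]

omit hsg hOK in
omit [DecidableEq W] [X.LocallyFinite] in
/-- **The last true target is the far face**: `π × {level = q + (nA+1)s₁, |trans| ≤ w₁ + nA·R'}`. [cite: KozmaNitzan2024, §4 Lemma 11] -/
theorem coreT_last_eq : P.coreT P.nA =
    P.π ×ˢ sBox P.ax P.sg P.c (P.q + ((P.nA : ℤ) + 1) * P.s₁) (P.q + ((P.nA : ℤ) + 1) * P.s₁) (Adv.w₁ P.q P.q' P.s₁ P.R' + (P.nA : ℤ) * P.R') := by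
  rw [coreT, acore, (Adv.core_zero_last (q := P.q) (q' := P.q') (s₁ := P.s₁) (R' := P.R') (N := P.nA) (a := P.ax) (σ := P.sg) (c := P.c)).2]

/-! ### The kits -/

/-- **`KitsAt` of the enlarged step `k`** (`k ≤ nA`) from a subbox region in the tube graph, finite support, the source off the region, the count
inequality and the per-level kit clause towards the enlarged target (p3-g2's `kitClauseQ` verbatim). [cite: KozmaNitzan2024, §4 Lemma 10 (p. 17)] -/
theorem kitsAt_stepA (hRl : P.Rlev + 1 ≤ P.R') (hRim : ∀ k, P.Rim k ⊆ P.stepD k) (hπ : P.π.Nonempty) {k : ℕ} (hk : k ≤ P.nA)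
    {Wt : Sym2 (W × Site 2) → unitInterval} {p : unitInterval} {Δ : ℕ} {δ : ℝ}
    (hsub : KNLevels.IsSubbox (tubeGraph X P.π) Wt p (P.stepD k)) (hfin : FinSupp Wt P.Sfin) (hDS : P.stepD k ⊆ P.Sfin)
    (ho : P.root ∉ P.stepD k) (hoS : P.root ∈ P.Sfin) (hj : P.j₁ ≤ P.Rlev)
    (hcount : 1 / (1 - (p : ℝ)) ^ (Δ * P.N) ≤ δ * ((Finset.Icc P.j₀ P.j₁).card : ℝ))
    (hkits : ∀ j ∈ Finset.Icc P.j₀ P.j₁, ∃ (σ : SData (W × Site 2)) (S : Finset (W × Site 2)),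
      SHyp (tubeLData X P.π (P.alo k) (P.ahi k) P.root P.Sfin) j σ ∧ σ.N ≤ P.N ∧
      (1 - (p : ℝ) ^ σ.sB) ^ σ.k ≤ δ ∧ S ⊆ (tubeLData X P.π (P.alo k) (P.ahi k) P.root P.Sfin).X j ∧ S ⊆ P.stepD k ∧
      (∀ x ∈ σ.K, ∀ e ∈ σ.seed x, e ∉ wireSet (↑S : Set (W × Site 2))) ∧ (∀ x ∈ σ.K, σ.face x ⊆ S) ∧
      (∀ x ∈ σ.K, 1 - 3 * δ ≤ (prodBernoulli Wt).real {ω | ∃ u ∈ σ.face x,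
        1 - δ < (prodBernoulli (pinW Wt (wireSet (↑S : Set (W × Site 2))) ω)).real
          (⋃ t ∈ P.coreE k, openConnIn (↑(P.stepD k) : Set (W × Site 2)) u t)})) :
    (P.stepA X k).KitsAt Wt p Δ δ :=
  ⟨lhyp_tube X P.π (P.alo k) (P.ahi k) hsub hfin hDS (encl X hsg hOK hRl hk) ho hoS, hj, coreE_subset_stepD hsg hOK hRim hk,
    (coreT_nonempty hsg hOK hπ k).mono (P.coreT_subset_coreE X k), hcount, hkits⟩

end TubeAdvData

end BoxProdZ2

end Transplant

end Summit.CriticalPhenomena.PercolationContinuityZ3.Theorems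

end
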